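import Literature.Algebra.Lie.CyclicLefschetzHighestWeights
import Literature.Algebra.Lie.Sl2ModuleWeights
import Mathlib.Algebra.Lie.SkewAdjoint
import Mathlib.LinearAlgebra.Eigenspace.Zero
import HarnessLib

/-!
# `𝔤𝔩(V(d)) = ⊕_{i=0}^{d} 𝔤𝔩^{(i)}(V(d))`: Looijenga–Lunts 1997, Appendix, Lemma (7.1)

Topic `Literature/Algebra/Lie` (namespace `Literature.Algebra.Lie`).  Lane `lit-hodgefound` (Track 2 foundations
library), skeleton seat `lit-hodgefound-skel-1` (generation 47), row **A1-154** of
`run/shared/lean/pub/lit-hodgefound/SKELETON.md`: the module-theoretic packaging of the Lemma opening Looijenga–Lunts'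
Appendix — the decomposition of `𝔤𝔩(V(d))` under the adjoint action of an `𝔰𝔩₂`-triple into the irreducible
submodules `𝔤𝔩^{(i)}(V(d))` generated by the powers `e^i`, `0 ≤ i ≤ d`, with `𝔤𝔩^{(0)}` = scalars, `𝔤𝔩^{(1)}` = the
image of `𝔰𝔩₂`, `𝔤𝔩^{(odd)} = 𝔞𝔲𝔱(V(d))` — whose two computational ingredients (the highest weight vectors of
`𝔤𝔩(V(d))` are the `c e^i`; `e^i` is coprimitive of weight `2i`; `⟨e^i x, y⟩ = (-)^i⟨x, e^i y⟩`) are row A1-153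
(`CyclicLefschetzHighestWeights`).  ONE DEFINITION (`glPart f e i` = `𝔤𝔩^{(i)}`, the span of the string of `e^i`
under `ad f`) and THEOREMS (no named fact, no `sorry`; D-0026 net debt `0`); the `𝔰𝔩₂`-module theory is the tree's
`Literature.Algebra.Lie.Sl2ModuleWeights` (Bourbaki, *Lie* VIII §1: primitive vectors in stable subspaces, string
modules, their simplicity and dimension, complete reducibility in submodule form); the commutator Lie ring on
`𝔤𝔩(M)` is Mathlib's reducible non-instance `LieRing.ofAssociativeRing`, enabled FILE-LOCALLY as in the whole series.

## Source, VERBATIM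

E. Looijenga, V. A. Lunts, *A Lie algebra attached to a projective variety*, Invent. Math. **129** (1997) 361–412
(held TeX text `paper:arxiv-alg-geom_9604014`), Appendix "a property of the orthogonal and symplectic Lie algebra's",
p0028 L14–L40:

> "As before, `V(d)` denotes the standard irreducible `𝔰𝔩₂`-module of dimension `d+1` […].
> **Lemma.** The decomposition of `𝔤𝔩(V(d))` into irreducible `𝔰𝔩₂`-submodules is
> `𝔤𝔩(V(d)) = ⊕_{i=0}^{d-1} 𝔤𝔩^{(i)}(V(d))`, where `𝔤𝔩^{(i)}(V(d))` is the `𝔰𝔩₂`-submodule generated by `e^i`.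
> Furthermore, `𝔤𝔩^{(0)}(V(d))` consists of the scalars, `𝔤𝔩^{(1)}(V(d))` can be identified with the image of `𝔰𝔩₂`
> in `𝔤𝔩(V(d))` and `𝔤𝔩^{(odd)}(V(d)) = 𝔞𝔲𝔱(V(d))`.
> *Proof.* Let `W` be an irreducible `𝔰𝔩₂`-submodule of `𝔤𝔩(V(d))` of dimension `m+1`. If `T ∈ W` is a highest
> weight vector, then `[e, T] = 0` and `[h, T] = mT`. Since `V(d)` is a monic `ℂ[e]`-module, it follows that `T` is a
> polynomial in `e` (of degree `≤ d`, of course). Since `[h, e^i] = 2i e^i` it follows that `m` is even and that `T`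
> is proportional to `e^{m/2}`. On the other hand is clear that for `i = 0, …, m`, `e^i` is coprimitive of weight
> `2i` and hence generates an irreducible `𝔰𝔩₂`-submodule of `𝔤𝔩(V(d))` of dimension `2i+1`. This proves the first
> part of the lemma. The identity `⟨e^i x, y⟩ = (-)^i ⟨x, e^i y⟩` shows that `e^i ∈ 𝔞𝔲𝔱(V(d))` if and only if `i` is
> odd."

(The printed upper limit `d - 1` of the sum is a misprint for `d`: `Σ_{i=0}^{d} (2i+1) = (d+1)² = dim 𝔤𝔩(V(d))`;
below the sum runs over `i < dim M = d + 1`, `sum_finrank_glPart`.)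

## Rendering

* `V(d)`: a finite-dimensional `K`-space `M` (`K` a field of characteristic `0`) with an `𝔰𝔩₂`-triple `(e, h, f)` of
  `𝔤𝔩(M)` (Mathlib `IsSl2Triple h e f` in `Module.End K M`) for which `e` is CYCLIC, `M = K[e] v` (the tree's
  `Literature.LinearAlgebra.cyclicSubspace e v = ⊤` — "`V(d)` is a monic `K[e]`-module"); that the irreducible module
  has this property is **`exists_cyclicSubspace_eq_top_of_forall_eq`** (§2); `d + 1 = dim M`.
* "`𝔰𝔩₂`-submodule of `𝔤𝔩(V(d))`": a `K`-subspace of `Module.End K M` stable under `ad e` and `ad f` (hence under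
  `ad h = [ad e, ad f]`); "irreducible": non-zero and without non-zero proper such subspace; `𝔤𝔩^{(i)}(V(d))` :=
  **`glPart f e i`** `= Σ_j K (ad f)^j e^i` (§1: the least `ad f`-stable subspace containing `e^i`, stable under
  `ad e, ad f, ad h`); `𝔞𝔲𝔱(V(d))` := Mathlib `B.skewAdjointSubmodule` for a non-degenerate form `B` with `e, f` skew.

## Contents (all proved)

* §1 `glPart` and its structure for `e^i ≠ 0`: stability (`lie_e_mem_glPart`, `lie_f_mem_glPart`, `lie_h_mem_glPart`,
  `glPart_le_of_pow_mem`), **`finrank_glPart`** (`dim 𝔤𝔩^{(i)} = 2i + 1`), **`eq_glPart_of_le`** (irreducibility),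
  **`glPart_zero`** (`𝔤𝔩^{(0)} = K·1`, "the scalars"), **`glPart_one`** / `glPart_one_eq_toLieSubalgebra`
  (`𝔤𝔩^{(1)} = Ke + Kf + Kh`, "the image of `𝔰𝔩₂`").
* §2 "`V(d)` is a monic `K[e]`-module": `exists_pow_apply_pow_apply_eq_smul`, **`exists_cyclicSubspace_eq_top_of_forall_eq`**.
* §3 "the first part of the lemma", for `e` cyclic: **`exists_eq_smul_pow_of_hasPrimitiveVectorWith`** (every highest
  weight vector of `𝔤𝔩(V(d))` is `c e^i`, of weight `2i`), `exists_pow_mem_of_forall_lie_mem`,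
  **`exists_eq_glPart_of_forall_eq`** (every irreducible submodule is a `𝔤𝔩^{(i)}`, of dimension `2i + 1`),
  **`eq_biSup_glPart_of_forall_lie_mem`** (every submodule is the sum of the `𝔤𝔩^{(i)}` with `e^i` in it),
  `iSup_glPart_eq_top`, `pow_eq_zero_of_finrank_le` / `glPart_eq_bot_of_finrank_le` (`e^i = 0`, `𝔤𝔩^{(i)} = 0` for
  `i > d`), `iSup_glPart_fin_eq_top`, `sum_finrank_glPart` (`Σ_{i≤d} (2i+1) = (d+1)² = dim 𝔤𝔩(V(d))`),
  **`iSupIndep_glPart`** and **`isInternal_glPart`**: `𝔤𝔩(V(d)) = ⊕_{i=0}^{d} 𝔤𝔩^{(i)}(V(d))` (Mathlib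
  `DirectSum.IsInternal` over `Fin (dim M)`).
* §4 **`skewAdjointSubmodule_eq_biSup_glPart`**: `𝔞𝔲𝔱(V(d)) = Σ_{i odd} 𝔤𝔩^{(i)}(V(d))`.
* §5 (rider A1-158, skeleton seat generation 48) the complement: `not_isSelfAdjoint_pow_of_odd`,
  **`selfAdjointSubmodule_eq_biSup_glPart`** (the self-adjoint operators `= Σ_{i even} 𝔤𝔩^{(i)}(V(d))`) and
  **`isCompl_skewAdjointSubmodule_selfAdjointSubmodule`** (`𝔤𝔩(V(d)) = 𝔞𝔲𝔱 ⊕ sym` along the parity of `⊕ 𝔤𝔩^{(i)}`).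

## SCOPE

(a) "can be identified with the image of `𝔰𝔩₂`" is rendered as the equality of subspaces `𝔤𝔩^{(1)} = Ke + Kf + Kh`
(`= (t.toLieSubalgebra K).toSubmodule`); the isomorphism `𝔰𝔩₂(K) ≅ Ke + Kf + Kh` (injectivity of `𝔰𝔩₂ → 𝔤𝔩(V(d))`,
`d ≥ 1`) is not restated.  (b) The existence / uniqueness of the invariant form `⟨ , ⟩` on `V(d)` is not part of this
row (it is hypothesised: `B` non-degenerate with `e, f` skew; cf. the series' `LefschetzModuleInvariantForm*`).
(c) The rest of the Appendix (Dynkin's theorems, Theorem (7.3)) is out of scope; nothing here concerns complex tori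
or the Hodge conjecture.

## References

* [LooijengaLunts1997] E. Looijenga, V. A. Lunts, *A Lie algebra attached to a projective variety*, Invent. Math. 129
  (1997) 361–412; arXiv:alg-geom/9604014. Appendix, Lemma (7.1), p. 28 L14–L40 of the held TeX text; §1 (1.15)
  proof, p. 8.
* [Bourbaki2008LieGroups79] N. Bourbaki, *Lie Groups and Lie Algebras, Chapters 7–9*, Ch. VIII §1 no. 1–3 — via the
  tree's `Literature.Algebra.Lie.Sl2ModuleWeights`.
-/

namespace Literature.Algebra.Lie

open Module Function Set LieAlgebra LieModule

attribute [local instance 100] LieRing.ofAssociativeRing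

section Parts

variable {K : Type*} [Field K] [CharZero K] {M : Type*} [AddCommGroup M] [Module K M] [FiniteDimensional K M]
  {h e f : Module.End K M}

/-- **`𝔤𝔩^{(i)}(M)`, "the `𝔰𝔩₂`-submodule generated by `e^i`"**: the `K`-span of the string
`e^i, (ad f) e^i, (ad f)² e^i, …` of the power `e^i` under `ad f` in `𝔤𝔩(M)` (for an `𝔰𝔩₂`-triple `(e, h, f)` of
`𝔤𝔩(M)` it is the least subspace containing `e^i` and stable under `ad e`, `ad f`, `ad h` — `glPart_le_of_pow_mem`,
`lie_e_mem_glPart`, `lie_f_mem_glPart`, `lie_h_mem_glPart`). [cite: LooijengaLunts1997, Appendix Lemma (7.1), p. 28 L19–L22] -/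
def glPart (f e : Module.End K M) (i : ℕ) : Submodule K (Module.End K M) :=
  Submodule.span K (Set.range fun j : ℕ ↦ ((LieAlgebra.ad K (Module.End K M) f) ^ j) (e ^ i))

omit [CharZero K] [FiniteDimensional K M] in
/-- `𝔤𝔩^{(i)}` in terms of Mathlib's `LieModule.toEnd` for the adjoint action (`ad f = toEnd f`), the form in which
the tree's string-module theory (`Literature.Algebra.Lie.Sl2ModuleWeights`) is stated.
[cite: LooijengaLunts1997, Appendix Lemma (7.1), p. 28 L19–L22 ("the 𝔰𝔩₂-submodule generated by e^i")] -/
theorem glPart_eq_span_toEnd (f e : Module.End K M) (i : ℕ) :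
    glPart f e i = Submodule.span K (Set.range fun j : ℕ ↦
      (LieModule.toEnd K (Module.End K M) (Module.End K M) f ^ j) (e ^ i)) := rfl

omit [CharZero K] [FiniteDimensional K M] in
/-- The members `(ad f)^j e^i` of the string lie in `𝔤𝔩^{(i)}`. [cite: LooijengaLunts1997, Appendix Lemma (7.1), p. 28 L19–L22] -/
theorem ad_pow_apply_pow_mem_glPart (f e : Module.End K M) (i j : ℕ) :
    ((LieAlgebra.ad K (Module.End K M) f) ^ j) (e ^ i) ∈ glPart f e i :=
  Submodule.subset_span ⟨j, rfl⟩

omit [CharZero K] [FiniteDimensional K M] in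
/-- `e^i ∈ 𝔤𝔩^{(i)}`. [cite: LooijengaLunts1997, Appendix Lemma (7.1), p. 28 L19–L22] -/
theorem pow_mem_glPart (f e : Module.End K M) (i : ℕ) : e ^ i ∈ glPart f e i := by
  have h1 := ad_pow_apply_pow_mem_glPart f e i 0
  rwa [pow_zero, Module.End.one_apply] at h1

omit [CharZero K] [FiniteDimensional K M] in
/-- If `e^i = 0` (i.e. `i > d`: "of degree `≤ d`, of course") the string is zero: `𝔤𝔩^{(i)} = 0`.
[cite: LooijengaLunts1997, Appendix Lemma (7.1), p. 28 L19–L22, L33–L34] -/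
theorem glPart_eq_bot_of_pow_eq_zero {i : ℕ} (hi : e ^ i = 0) : glPart f e i = ⊥ := by
  rw [glPart, Submodule.span_eq_bot]
  rintro _ ⟨j, rfl⟩
  dsimp only
  rw [hi, map_zero]

omit [CharZero K] [FiniteDimensional K M] in
/-- `𝔤𝔩^{(i)}` is the LEAST subspace of `𝔤𝔩(M)` containing `e^i` and stable under `ad f`.
[cite: LooijengaLunts1997, Appendix Lemma (7.1), p. 28 L19–L22 ("the 𝔰𝔩₂-submodule generated by e^i")] -/
theorem glPart_le_of_pow_mem {N : Submodule K (Module.End K M)} {i : ℕ} (hi : e ^ i ∈ N)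
    (hfN : ∀ x ∈ N, ⁅f, x⁆ ∈ N) : glPart f e i ≤ N := by
  rw [glPart_eq_span_toEnd]
  exact span_pow_toEnd_f_le hi hfN

omit [CharZero K] [FiniteDimensional K M] in
/-- `e^i` is a primitive vector of weight `2i` (cast from `ℕ`) for the adjoint action — the form the string theorems
of `Sl2ModuleWeights` take. [cite: LooijengaLunts1997, Appendix Lemma (7.1) proof, p. 28 L36–L38] -/
theorem hasPrimitiveVectorWith_pow' (t : IsSl2Triple h e f) {i : ℕ} (hi : e ^ i ≠ 0) :
    t.HasPrimitiveVectorWith (e ^ i) ((2 * i : ℕ) : K) := by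
  rw [Nat.cast_mul, Nat.cast_ofNat]
  exact hasPrimitiveVectorWith_pow t hi

omit [CharZero K] [FiniteDimensional K M] in
/-- `𝔤𝔩^{(i)}` is stable under `ad f` … [cite: LooijengaLunts1997, Appendix Lemma (7.1), p. 28 L19–L22] -/
theorem lie_f_mem_glPart (f e : Module.End K M) {i : ℕ} {x : Module.End K M} (hx : x ∈ glPart f e i) :
    ⁅f, x⁆ ∈ glPart f e i := by
  refine Submodule.span_induction (p := fun x _ ↦ ⁅f, x⁆ ∈ glPart f e i) ?_ (by rw [lie_zero]; exact Submodule.zero_mem _)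
    (fun x y _ _ hx hy ↦ by rw [lie_add]; exact Submodule.add_mem _ hx hy)
    (fun c x _ hx ↦ by rw [lie_smul]; exact Submodule.smul_mem _ c hx) hx
  rintro _ ⟨j, rfl⟩
  refine Submodule.subset_span ⟨j + 1, ?_⟩
  dsimp only
  rw [pow_succ', Module.End.mul_apply, LieAlgebra.ad_apply]

omit [CharZero K] [FiniteDimensional K M] in
/-- … under `ad e` … [cite: LooijengaLunts1997, Appendix Lemma (7.1), p. 28 L19–L22] -/
theorem lie_e_mem_glPart (t : IsSl2Triple h e f) {i : ℕ} {x : Module.End K M} (hx : x ∈ glPart f e i) :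
    ⁅e, x⁆ ∈ glPart f e i := by
  by_cases hi : e ^ i = 0
  · rw [glPart_eq_bot_of_pow_eq_zero hi, Submodule.mem_bot] at hx ⊢
    rw [hx, lie_zero]
  · rw [glPart_eq_span_toEnd] at hx ⊢
    exact IsSl2Triple.HasPrimitiveVectorWith.lie_e_mem_span (hasPrimitiveVectorWith_pow t hi) hx

omit [CharZero K] [FiniteDimensional K M] in
/-- … and under `ad h`: it is an `𝔰𝔩₂`-submodule of `𝔤𝔩(M)`. [cite: LooijengaLunts1997, Appendix Lemma (7.1), p. 28 L19–L22] -/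
theorem lie_h_mem_glPart (t : IsSl2Triple h e f) {i : ℕ} {x : Module.End K M} (hx : x ∈ glPart f e i) :
    ⁅h, x⁆ ∈ glPart f e i := by
  rw [← t.lie_e_f, lie_lie]
  exact Submodule.sub_mem _ (lie_e_mem_glPart t (lie_f_mem_glPart f e hx)) (lie_f_mem_glPart f e (lie_e_mem_glPart t hx))

/-- **"`e^i` … generates an irreducible `𝔰𝔩₂`-submodule of `𝔤𝔩(V(d))` of dimension `2i+1`"** — the dimension:
`dim 𝔤𝔩^{(i)} = 2i + 1` when `e^i ≠ 0`. [cite: LooijengaLunts1997, Appendix Lemma (7.1) proof, p. 28 L36–L38] -/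
theorem finrank_glPart (t : IsSl2Triple h e f) {i : ℕ} (hi : e ^ i ≠ 0) : finrank K (glPart f e i) = 2 * i + 1 := by
  rw [glPart_eq_span_toEnd]
  exact IsSl2Triple.HasPrimitiveVectorWith.finrank_span_pow_toEnd_f (hasPrimitiveVectorWith_pow' t hi)

/-- … and the irreducibility: a non-zero subspace of `𝔤𝔩^{(i)}` stable under `ad e` and `ad f` is all of `𝔤𝔩^{(i)}`.
[cite: LooijengaLunts1997, Appendix Lemma (7.1) proof, p. 28 L36–L38] -/
theorem eq_glPart_of_le (t : IsSl2Triple h e f) {i : ℕ} (hi : e ^ i ≠ 0) {N : Submodule K (Module.End K M)}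
    (hN : N ≤ glPart f e i) (hN0 : N ≠ ⊥) (heN : ∀ x ∈ N, ⁅e, x⁆ ∈ N) (hfN : ∀ x ∈ N, ⁅f, x⁆ ∈ N) :
    N = glPart f e i := by
  rw [glPart_eq_span_toEnd] at hN ⊢
  exact IsSl2Triple.HasPrimitiveVectorWith.eq_span_of_le_of_forall_lie_mem (hasPrimitiveVectorWith_pow' t hi) hN hN0
    heN hfN

omit [CharZero K] [FiniteDimensional K M] in
/-- **"`𝔤𝔩^{(0)}(V(d))` consists of the scalars"**: `𝔤𝔩^{(0)} = K · 1`. [cite: LooijengaLunts1997, Appendix Lemma (7.1), p. 28 L23] -/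
theorem glPart_zero (f e : Module.End K M) : glPart f e 0 = K ∙ (1 : Module.End K M) := by
  refine le_antisymm ?_ ((Submodule.span_singleton_le_iff_mem _ _).2 ?_)
  · rw [glPart, Submodule.span_le]
    rintro _ ⟨j, rfl⟩
    rw [SetLike.mem_coe]
    dsimp only
    cases j with
    | zero => rw [pow_zero, pow_zero, Module.End.one_apply]; exact Submodule.mem_span_singleton_self _
    | succ j =>
      rw [pow_zero, pow_succ, Module.End.mul_apply, ad_apply_one_eq_zero, map_zero]
      exact Submodule.zero_mem _
  · have h1 := pow_mem_glPart f e 0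
    rwa [pow_zero] at h1

/-- **"`𝔤𝔩^{(1)}(V(d))` can be identified with the image of `𝔰𝔩₂` in `𝔤𝔩(V(d))`"**: `𝔤𝔩^{(1)} = Ke + Kf + Kh`
(the string `e, -h, -2f, 0, …`). [cite: LooijengaLunts1997, Appendix Lemma (7.1), p. 28 L23–L24] -/
theorem glPart_one (t : IsSl2Triple h e f) : glPart f e 1 = Submodule.span K ({e, f, h} : Set (Module.End K M)) := by
  rw [← span_string_e_eq t]
  have he1 : e ^ 1 ≠ 0 := by rw [pow_one]; exact t.e_ne_zero
  refine le_antisymm ?_ (Submodule.span_mono ?_)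
  · rw [glPart, Submodule.span_le]
    rintro _ ⟨j, rfl⟩
    rw [SetLike.mem_coe]
    dsimp only
    rcases lt_or_ge j 3 with hj | hj
    · refine Submodule.subset_span ?_
      interval_cases j
      · exact Or.inl (by rw [pow_zero, pow_one, Module.End.one_apply])
      · exact Or.inr (Or.inl (by rw [pow_one, pow_one]))
      · exact Or.inr (Or.inr (Set.mem_singleton_iff.2 (by rw [pow_one])))
    · obtain ⟨c, rfl⟩ := Nat.exists_eq_add_of_le hj
      have h3 := ad_pow_apply_pow_eq_zero t he1
      rw [add_comm, pow_add, Module.End.mul_apply, h3, map_zero]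
      exact Submodule.zero_mem _
  · intro x hx
    simp only [Set.mem_insert_iff, Set.mem_singleton_iff] at hx
    rcases hx with rfl | rfl | rfl
    · exact ⟨0, by dsimp only; rw [pow_zero, pow_one, Module.End.one_apply]⟩
    · exact ⟨1, by dsimp only; rw [pow_one, pow_one]⟩
    · exact ⟨2, by dsimp only; rw [pow_one]⟩

/-- … i.e. `𝔤𝔩^{(1)}` is the underlying subspace of the subalgebra `t.toLieSubalgebra K = Ke + Kf + Kh` (Mathlib).
[cite: LooijengaLunts1997, Appendix Lemma (7.1), p. 28 L23–L24] -/
theorem glPart_one_eq_toLieSubalgebra (t : IsSl2Triple h e f) : glPart f e 1 = (t.toLieSubalgebra K).toSubmodule := by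
  rw [glPart_one t]
  rfl

end Parts

/-! ### "`V(d)` is a monic `K[e]`-module": in the irreducible module `V(d)` the operator `e` is cyclic -/

section Monic

variable {K : Type*} [Field K] [CharZero K] {M : Type*} [AddCommGroup M] [Module K M] [FiniteDimensional K M]
  {h e f : Module.End K M}

omit [FiniteDimensional K M] in
/-- In the string `v₀, f v₀, f² v₀, …` of a highest weight vector `v₀ ∈ M` of weight `n` (for a triple `(e, h, f)` of
`𝔤𝔩(M)` acting tautologically), `e^m f^{j+m} v₀` is a NON-ZERO multiple of `f^j v₀` as long as `j + m ≤ n` (iterate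
Mathlib's `IsSl2Triple.HasPrimitiveVectorWith.lie_e_pow_succ_toEnd_f`: `e f^{k+1} v₀ = (k+1)(n-k) f^k v₀`).
[cite: LooijengaLunts1997, §1 (1.15) proof, p. 8 ("V(n) ≅ K[e]/(e^{n+1})")] -/
theorem exists_pow_apply_pow_apply_eq_smul (t : IsSl2Triple h e f) {v₀ : M} {n : ℕ}
    (P : t.HasPrimitiveVectorWith v₀ (n : K)) {j m : ℕ} (hjm : j + m ≤ n) :
    ∃ c : K, c ≠ 0 ∧ (e ^ m) ((f ^ (j + m)) v₀) = c • (f ^ j) v₀ := by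
  induction m with
  | zero => exact ⟨1, one_ne_zero, by rw [pow_zero, Module.End.one_apply, add_zero, one_smul]⟩
  | succ m ih =>
    obtain ⟨c, hc, hcm⟩ := ih (by omega)
    have h1 := P.lie_e_pow_succ_toEnd_f (j + m)
    simp only [LieModule.toEnd_module_end, LieHom.id_apply, Module.End.lie_apply] at h1
    refine ⟨(((j + m : ℕ) : K) + 1) * ((n : K) - (j + m : ℕ)) * c, mul_ne_zero (mul_ne_zero ?_ ?_) hc, ?_⟩
    · exact Nat.cast_add_one_ne_zero (j + m)
    · exact sub_ne_zero.2 (Nat.cast_injective.ne (by omega))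
    · rw [pow_succ, Module.End.mul_apply, ← add_assoc, h1, map_smul, hcm, smul_smul]

/-- **"`V(d)` is a monic `K[e]`-module"**: if `M ≠ 0` is IRREDUCIBLE under the triple `(e, h, f)` of `𝔤𝔩(M)` (no
subspace stable under `e` and `f` other than `0` and `M` — the standard irreducible module `V(d)`, `d + 1 = dim M`,
by the tree's `IsSl2Triple.exists_hasPrimitiveVectorWith_span_eq_top`), then `e` is CYCLIC on `M`: `M = K[e] v` for
`v = f^d v₀`, `v₀` a highest weight vector (the tree's `Literature.LinearAlgebra.cyclicSubspace e v = ⊤`, the hypothesis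
under which the rest of this file and `CyclicLefschetzHighestWeights` are stated).
[cite: LooijengaLunts1997, Appendix Lemma (7.1) proof, p. 28 L32–L33; §1 (1.15) proof, p. 8] -/
theorem exists_cyclicSubspace_eq_top_of_forall_eq [Nontrivial M] (t : IsSl2Triple h e f)
    (hmin : ∀ N : Submodule K M, N ≠ ⊥ → (∀ x ∈ N, e x ∈ N) → (∀ x ∈ N, f x ∈ N) → N = ⊤) :
    ∃ v : M, Literature.LinearAlgebra.cyclicSubspace e v = ⊤ := by
  obtain ⟨v₀, n, P, hspan, -⟩ := IsSl2Triple.exists_hasPrimitiveVectorWith_span_eq_top (k := K) (M := M) t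
    fun N hN heN hfN ↦ hmin N hN (fun x hx ↦ heN x hx) (fun x hx ↦ hfN x hx)
  simp only [LieModule.toEnd_module_end, LieHom.id_apply] at hspan
  refine ⟨(f ^ n) v₀, top_unique (hspan.ge.trans (Submodule.span_le.2 ?_))⟩
  rintro _ ⟨j, rfl⟩
  rw [SetLike.mem_coe]
  dsimp only
  by_cases hj : j ≤ n
  · obtain ⟨m, rfl⟩ := Nat.exists_eq_add_of_le hj
    obtain ⟨c, hc, hcm⟩ := exists_pow_apply_pow_apply_eq_smul t P (j := j) (m := m) le_rfl
    have h1 : (f ^ j) v₀ = c⁻¹ • (e ^ m) ((f ^ (j + m)) v₀) := by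
      rw [hcm, smul_smul, inv_mul_cancel₀ hc, one_smul]
    rw [h1]
    refine Submodule.smul_mem _ _ ?_
    rw [Literature.LinearAlgebra.cyclicSubspace_eq_span]
    exact Submodule.subset_span ⟨m, rfl⟩
  · have h0 := IsSl2Triple.HasPrimitiveVectorWith.pow_toEnd_f_eq_zero_of_lt P (not_le.1 hj)
    simp only [LieModule.toEnd_module_end, LieHom.id_apply] at h0
    rw [h0]
    exact Submodule.zero_mem _

end Monic

/-! ### "This proves the first part of the lemma": for `e` cyclic, every irreducible `𝔰𝔩₂`-submodule of `𝔤𝔩(M)` is a `𝔤𝔩^{(i)}` -/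

section Cyclic

variable {K : Type*} [Field K] [CharZero K] {M : Type*} [AddCommGroup M] [Module K M] [FiniteDimensional K M]
  {h e f : Module.End K M}

/-- **The highest weight vectors of `𝔤𝔩(V(d))` are the multiples of the powers `e^i`, of weight `2i`** ("If `T ∈ W`
is a highest weight vector, then `[e, T] = 0` and `[h, T] = mT` … `m` is even and … `T` is proportional to
`e^{m/2}`"): for `e` CYCLIC on `M`, every primitive vector `T` of `𝔤𝔩(M)` (adjoint action) is `c e^i` with `c ≠ 0`,
`e^i ≠ 0`, and its weight is `2i`. [cite: LooijengaLunts1997, Appendix Lemma (7.1) proof, p. 28 L31–L36] -/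
theorem exists_eq_smul_pow_of_hasPrimitiveVectorWith (t : IsSl2Triple h e f) {v : M}
    (hcyc : Literature.LinearAlgebra.cyclicSubspace e v = ⊤) {T : Module.End K M} {μ : K}
    (P : t.HasPrimitiveVectorWith T μ) : ∃ (i : ℕ) (c : K), c ≠ 0 ∧ e ^ i ≠ 0 ∧ T = c • e ^ i ∧ μ = 2 * (i : K) := by
  -- the weight is a natural number `n`
  obtain ⟨n, hn⟩ := P.exists_nat
  -- `T` commutes with `e`
  have hT : T * e = e * T := by
    have h1 := P.lie_e
    rw [Ring.lie_def, sub_eq_zero] at h1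
    exact h1.symm
  have hTn : T ∈ adDegree K h (n : K) := by rw [mem_adDegree_iff, ← hn]; exact P.lie_h
  rcases Nat.even_or_odd n with ⟨i, hi⟩ | ho
  · have hTi : T ∈ adDegree K h (2 * (i : K)) := by rw [two_mul, ← Nat.cast_add, ← hi]; exact hTn
    obtain ⟨c, hc⟩ := exists_eq_smul_pow_of_commute_of_mem_adDegree (e_mem_adDegree t) hcyc hT hTi
    have hc0 : c ≠ 0 := by rintro rfl; exact P.ne_zero (by rw [hc, zero_smul])
    have hei : e ^ i ≠ 0 := by intro h0; exact P.ne_zero (by rw [hc, h0, smul_zero])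
    exact ⟨i, c, hc0, hei, hc, by rw [hn, hi]; push_cast; ring⟩
  · exfalso
    refine P.ne_zero (eq_zero_of_commute_of_mem_adDegree (e_mem_adDegree t) hcyc hT (m := (n : ℤ)) (fun i h2 ↦ ?_)
      (by push_cast; exact hTn))
    obtain ⟨r, hr⟩ := ho
    omega

/-- Hence **every non-zero `ad e, ad f`-stable subspace of `𝔤𝔩(V(d))` contains a power `e^i ≠ 0`** (its highest weight
vectors). [cite: LooijengaLunts1997, Appendix Lemma (7.1) proof, p. 28 L31–L36] -/
theorem exists_pow_mem_of_forall_lie_mem (t : IsSl2Triple h e f) {v : M}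
    (hcyc : Literature.LinearAlgebra.cyclicSubspace e v = ⊤) {N : Submodule K (Module.End K M)} (hN0 : N ≠ ⊥)
    (heN : ∀ x ∈ N, ⁅e, x⁆ ∈ N) (hfN : ∀ x ∈ N, ⁅f, x⁆ ∈ N) : ∃ i : ℕ, e ^ i ≠ 0 ∧ e ^ i ∈ N := by
  obtain ⟨n, T, hTN, P⟩ := IsSl2Triple.exists_hasPrimitiveVectorWith_mem (k := K) (M := Module.End K M) t hN0 heN hfN
  obtain ⟨i, c, hc, hei, hT, -⟩ := exists_eq_smul_pow_of_hasPrimitiveVectorWith t hcyc P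
  refine ⟨i, hei, ?_⟩
  have h1 : e ^ i = c⁻¹ • T := by rw [hT, smul_smul, inv_mul_cancel₀ hc, one_smul]
  rw [h1]
  exact N.smul_mem _ hTN

/-- **LEMMA (7.1), "the first part": every irreducible `𝔰𝔩₂`-submodule `W` of `𝔤𝔩(V(d))` is `𝔤𝔩^{(i)}(V(d))` for some
`i` with `e^i ≠ 0`, and `dim W = 2i + 1`** ("Let `W` be an irreducible `𝔰𝔩₂`-submodule of `𝔤𝔩(V(d))` of dimension
`m+1` … `T` is proportional to `e^{m/2}` … `e^i` … generates an irreducible `𝔰𝔩₂`-submodule … of dimension `2i+1`";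
irreducible = non-zero, `ad e, ad f`-stable, without non-zero proper such subspace).
[cite: LooijengaLunts1997, Appendix Lemma (7.1), p. 28 L19–L22, L31–L38] -/
theorem exists_eq_glPart_of_forall_eq (t : IsSl2Triple h e f) {v : M}
    (hcyc : Literature.LinearAlgebra.cyclicSubspace e v = ⊤) {N : Submodule K (Module.End K M)} (hN0 : N ≠ ⊥)
    (heN : ∀ x ∈ N, ⁅e, x⁆ ∈ N) (hfN : ∀ x ∈ N, ⁅f, x⁆ ∈ N)
    (hmin : ∀ N' : Submodule K (Module.End K M), N' ≤ N → N' ≠ ⊥ → (∀ x ∈ N', ⁅e, x⁆ ∈ N') →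
      (∀ x ∈ N', ⁅f, x⁆ ∈ N') → N' = N) :
    ∃ i : ℕ, e ^ i ≠ 0 ∧ N = glPart f e i ∧ finrank K N = 2 * i + 1 := by
  obtain ⟨i, hei, hiN⟩ := exists_pow_mem_of_forall_lie_mem t hcyc hN0 heN hfN
  have hle : glPart f e i ≤ N := glPart_le_of_pow_mem hiN hfN
  have hne : glPart f e i ≠ ⊥ := fun h0 ↦ hei ((Submodule.mem_bot K).1 (h0 ▸ pow_mem_glPart f e i))
  have heq := hmin _ hle hne (fun x hx ↦ lie_e_mem_glPart t hx) (fun x hx ↦ lie_f_mem_glPart f e hx)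
  exact ⟨i, hei, heq.symm, by rw [← heq, finrank_glPart t hei]⟩

/-- **Every `ad e, ad f`-stable subspace of `𝔤𝔩(V(d))` is the sum of the `𝔤𝔩^{(i)}` it meets** (complete reducibility —
the tree's `IsSl2Triple.exists_supIndep_span_string`, Bourbaki VIII §1 no. 3 Thm. 1 — and the first part: each
irreducible constituent is the `𝔤𝔩^{(i)}` of its highest weight vector `c e^i`).
[cite: LooijengaLunts1997, Appendix Lemma (7.1), p. 28 L19–L22, L31–L38] -/
theorem eq_biSup_glPart_of_forall_lie_mem (t : IsSl2Triple h e f) {v : M}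
    (hcyc : Literature.LinearAlgebra.cyclicSubspace e v = ⊤) {N : Submodule K (Module.End K M)}
    (heN : ∀ x ∈ N, ⁅e, x⁆ ∈ N) (hfN : ∀ x ∈ N, ⁅f, x⁆ ∈ N) : N = ⨆ (i : ℕ) (_ : e ^ i ∈ N), glPart f e i := by
  refine le_antisymm ?_ (iSup₂_le fun i hi ↦ glPart_le_of_pow_mem hi hfN)
  obtain ⟨S, -, hsup, hmem⟩ := IsSl2Triple.exists_supIndep_span_string (k := K) (M := Module.End K M) t heN hfN
  have hSN : ∀ V ∈ S, V ≤ N := fun V hV ↦ by rw [← hsup]; exact Finset.le_sup (f := id) hV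
  nth_rw 1 [← hsup]
  refine Finset.sup_le fun V hV ↦ ?_
  obtain ⟨T, n, P, hVT⟩ := hmem V hV
  obtain ⟨i, c, hc, -, hT, -⟩ := exists_eq_smul_pow_of_hasPrimitiveVectorWith t hcyc P
  have hTV : T ∈ V := by
    rw [hVT]
    exact Submodule.subset_span ⟨0, by dsimp only; rw [pow_zero, Module.End.one_apply]⟩
  have hiN : e ^ i ∈ N := by
    have h1 : e ^ i = c⁻¹ • T := by rw [hT, smul_smul, inv_mul_cancel₀ hc, one_smul]
    rw [h1]
    exact N.smul_mem _ (hSN V hV hTV)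
  have hVle : V ≤ glPart f e i := by
    rw [hVT]
    exact span_pow_toEnd_f_le (by rw [hT]; exact (glPart f e i).smul_mem c (pow_mem_glPart f e i))
      fun x hx ↦ lie_f_mem_glPart f e hx
  exact hVle.trans (le_iSup₂_of_le i hiN le_rfl)

/-- So **`𝔤𝔩(V(d)) = Σ_i 𝔤𝔩^{(i)}(V(d))`**. [cite: LooijengaLunts1997, Appendix Lemma (7.1), p. 28 L19–L22] -/
theorem iSup_glPart_eq_top (t : IsSl2Triple h e f) {v : M} (hcyc : Literature.LinearAlgebra.cyclicSubspace e v = ⊤) :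
    ⨆ i : ℕ, glPart f e i = ⊤ := by
  have h1 := eq_biSup_glPart_of_forall_lie_mem t hcyc (N := ⊤) (fun _ _ ↦ Submodule.mem_top)
    fun _ _ ↦ Submodule.mem_top
  exact top_unique (h1.le.trans (iSup₂_le fun i _ ↦ le_iSup (glPart f e) i))

/-- `e` is nilpotent: `e^{dim M} = 0` (`e` belongs to an `𝔰𝔩₂`-triple of `𝔤𝔩(M)`, `M` finite-dimensional of
characteristic `0`; the tree's `IsSl2Triple.isNilpotent_toEnd_e` with Cayley–Hamilton), so `e^i = 0` for `i > d`,
`d + 1 = dim M` ("of degree `≤ d`, of course"). [cite: LooijengaLunts1997, Appendix Lemma (7.1) proof, p. 28 L33–L34] -/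
theorem pow_eq_zero_of_finrank_le (t : IsSl2Triple h e f) {i : ℕ} (hi : finrank K M ≤ i) : e ^ i = 0 := by
  have hn : IsNilpotent e := by
    have h1 := IsSl2Triple.isNilpotent_toEnd_e (k := K) (M := M) t
    rwa [LieModule.toEnd_module_end, LieHom.id_apply] at h1
  have hc := (LinearMap.isNilpotent_iff_charpoly e).1 hn
  have h2 := e.aeval_self_charpoly
  rw [hc, map_pow, Polynomial.aeval_X] at h2
  obtain ⟨c, rfl⟩ := Nat.exists_eq_add_of_le hi
  rw [pow_add, h2, zero_mul]

/-- … hence `𝔤𝔩^{(i)} = 0` for `i ≥ dim M`. [cite: LooijengaLunts1997, Appendix Lemma (7.1), p. 28 L19–L22] -/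
theorem glPart_eq_bot_of_finrank_le (t : IsSl2Triple h e f) {i : ℕ} (hi : finrank K M ≤ i) : glPart f e i = ⊥ :=
  glPart_eq_bot_of_pow_eq_zero (pow_eq_zero_of_finrank_le t hi)

/-- **`𝔤𝔩(V(d)) = Σ_{i=0}^{d} 𝔤𝔩^{(i)}(V(d))`**, `d + 1 = dim V(d)` (the printed upper limit `d - 1` is a misprint).
[cite: LooijengaLunts1997, Appendix Lemma (7.1), p. 28 L19–L22] -/
theorem iSup_glPart_fin_eq_top (t : IsSl2Triple h e f) {v : M} (hcyc : Literature.LinearAlgebra.cyclicSubspace e v = ⊤) :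
    ⨆ i : Fin (finrank K M), glPart f e (i : ℕ) = ⊤ := by
  refine top_unique ((iSup_glPart_eq_top t hcyc).ge.trans (iSup_le fun i ↦ ?_))
  by_cases hi : i < finrank K M
  · exact le_iSup (fun i : Fin (finrank K M) ↦ glPart f e (i : ℕ)) ⟨i, hi⟩
  · rw [glPart_eq_bot_of_finrank_le t (not_lt.1 hi)]
    exact bot_le

omit [CharZero K] in
/-- `dim (Σ_{i ∈ s} A_i) ≤ Σ_{i ∈ s} dim A_i`. [folklore] -/
private theorem finrank_finsetSup_le_sum_aux {ι : Type*} (A : ι → Submodule K (Module.End K M)) (s : Finset ι) :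
    finrank K ↥(s.sup A) ≤ ∑ i ∈ s, finrank K (A i) := by
  classical
  induction s using Finset.induction_on with
  | empty => simp
  | insert a s ha ih =>
    rw [Finset.sup_insert, Finset.sum_insert ha]
    exact (Submodule.finrank_add_le_finrank_add_finrank _ _).trans (by omega)

omit [CharZero K] in
/-- A finite family of subspaces whose supremum has dimension the sum of the dimensions is independent. [folklore] -/
private theorem supIndep_of_finrank_finsetSup_eq_aux {ι : Type*} {A : ι → Submodule K (Module.End K M)} {s : Finset ι}
    (hs : finrank K ↥(s.sup A) = ∑ i ∈ s, finrank K (A i)) : s.SupIndep A := by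
  classical
  induction s using Finset.induction_on with
  | empty => exact Finset.supIndep_empty _
  | insert a s ha ih =>
    rw [Finset.sup_insert, Finset.sum_insert ha] at hs
    have h1 := Submodule.finrank_sup_add_finrank_inf_eq (A a) (s.sup A)
    have h2 := finrank_finsetSup_le_sum_aux (K := K) A s
    have h3 : finrank K ↥(A a ⊓ s.sup A) = 0 := by omega
    have h4 : finrank K ↥(s.sup A) = ∑ i ∈ s, finrank K (A i) := by omega
    refine (ih h4).insert ?_
    rw [disjoint_iff, ← Submodule.finrank_eq_zero]
    exact h3

omit [CharZero K] [FiniteDimensional K M] in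
/-- The dimension count `Σ_{i=0}^{d} (2i + 1) = (d + 1)²`. [cite: LooijengaLunts1997, Appendix Lemma (7.1), p. 28 L19–L22] -/
theorem sum_range_two_mul_add_one (n : ℕ) : ∑ i ∈ Finset.range n, (2 * i + 1) = n ^ 2 := by
  induction n with
  | zero => simp
  | succ n ih => rw [Finset.sum_range_succ, ih]; ring

/-- `Σ_{i=0}^{d} dim 𝔤𝔩^{(i)}(V(d)) = (d + 1)² = dim 𝔤𝔩(V(d))`. [cite: LooijengaLunts1997, Appendix Lemma (7.1), p. 28 L19–L22] -/
theorem sum_finrank_glPart (t : IsSl2Triple h e f) {v : M} (hcyc : Literature.LinearAlgebra.cyclicSubspace e v = ⊤) :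
    ∑ i : Fin (finrank K M), finrank K (glPart f e (i : ℕ)) = finrank K (Module.End K M) := by
  have h1 : ∀ i : Fin (finrank K M), finrank K (glPart f e (i : ℕ)) = 2 * (i : ℕ) + 1 :=
    fun i ↦ finrank_glPart t (pow_ne_zero_of_lt_finrank hcyc i.isLt)
  simp_rw [h1]
  rw [Fin.sum_univ_eq_sum_range (fun i ↦ 2 * i + 1), sum_range_two_mul_add_one, Module.finrank_linearMap, sq]

/-- **The sum is direct: `𝔤𝔩(V(d)) = ⊕_{i=0}^{d} 𝔤𝔩^{(i)}(V(d))`** (independence of the family, by the dimension count).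
[cite: LooijengaLunts1997, Appendix Lemma (7.1), p. 28 L19–L22] -/
theorem iSupIndep_glPart (t : IsSl2Triple h e f) {v : M} (hcyc : Literature.LinearAlgebra.cyclicSubspace e v = ⊤) :
    iSupIndep fun i : Fin (finrank K M) ↦ glPart f e (i : ℕ) := by
  rw [iSupIndep_iff_supIndep_univ]
  apply supIndep_of_finrank_finsetSup_eq_aux
  rw [Finset.sup_univ_eq_iSup, iSup_glPart_fin_eq_top t hcyc, finrank_top, sum_finrank_glPart t hcyc]

/-- **LEMMA (7.1): `𝔤𝔩(V(d)) = ⊕_{i=0}^{d} 𝔤𝔩^{(i)}(V(d))`** as an internal direct sum (Mathlib `DirectSum.IsInternal`),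
for the standard irreducible module `V(d)` presented as `M` with `e` cyclic, `d + 1 = dim M`.
[cite: LooijengaLunts1997, Appendix Lemma (7.1), p. 28 L19–L22] -/
theorem isInternal_glPart (t : IsSl2Triple h e f) {v : M} (hcyc : Literature.LinearAlgebra.cyclicSubspace e v = ⊤) :
    DirectSum.IsInternal fun i : Fin (finrank K M) ↦ glPart f e (i : ℕ) :=
  (DirectSum.isInternal_submodule_iff_iSupIndep_and_iSup_eq_top _).2
    ⟨iSupIndep_glPart t hcyc, iSup_glPart_fin_eq_top t hcyc⟩

end Cyclic

/-! ### "`𝔤𝔩^{(odd)}(V(d)) = 𝔞𝔲𝔱(V(d))`" -/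

section Aut

variable {K : Type*} [Field K] [CharZero K] {M : Type*} [AddCommGroup M] [Module K M] [FiniteDimensional K M]
  {h e f : Module.End K M} {B : LinearMap.BilinForm K M}

omit [CharZero K] [FiniteDimensional K M] in
/-- `𝔞𝔲𝔱(M, ⟨ , ⟩)` (Mathlib `B.skewAdjointSubmodule`) is stable under `ad a` for `a ∈ 𝔞𝔲𝔱(M, ⟨ , ⟩)` (Mathlib
`LinearMap.BilinForm.isSkewAdjoint_bracket`). [folklore] -/
private theorem lie_mem_skewAdjointSubmodule_aux {a x : Module.End K M} (ha : B.IsSkewAdjoint a) (hx : x ∈ B.skewAdjointSubmodule) :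
    ⁅a, x⁆ ∈ B.skewAdjointSubmodule :=
  B.isSkewAdjoint_bracket ((LinearMap.mem_skewAdjointSubmodule a).2 ha) hx

/-- **LEMMA (7.1), last clause: "`𝔤𝔩^{(odd)}(V(d)) = 𝔞𝔲𝔱(V(d))`"** — for a non-degenerate form `⟨ , ⟩` on `V(d)` for
which `e` and `f` are skew ("the image of `𝔰𝔩₂`" lies in `𝔞𝔲𝔱(V(d))`), the Lie algebra `𝔞𝔲𝔱(V(d), ⟨ , ⟩)` of skew
endomorphisms is the sum of the `𝔤𝔩^{(i)}(V(d))` with `i` odd ("The identity `⟨e^i x, y⟩ = (-)^i ⟨x, e^i y⟩` shows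
that `e^i ∈ 𝔞𝔲𝔱(V(d))` if and only if `i` is odd" — `isSkewAdjoint_pow_of_odd`, `not_isSkewAdjoint_pow_of_even`).
[cite: LooijengaLunts1997, Appendix Lemma (7.1), p. 28 L24, L38–L40] -/
theorem skewAdjointSubmodule_eq_biSup_glPart (t : IsSl2Triple h e f) {v : M}
    (hcyc : Literature.LinearAlgebra.cyclicSubspace e v = ⊤) (hB : B.Nondegenerate) (he : B.IsSkewAdjoint e)
    (hf : B.IsSkewAdjoint f) : B.skewAdjointSubmodule = ⨆ (i : ℕ) (_ : Odd i), glPart f e i := by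
  have h1 := eq_biSup_glPart_of_forall_lie_mem t hcyc (N := B.skewAdjointSubmodule)
    (fun x hx ↦ lie_mem_skewAdjointSubmodule_aux he hx) (fun x hx ↦ lie_mem_skewAdjointSubmodule_aux hf hx)
  refine h1.trans (le_antisymm (iSup₂_le fun i hi ↦ ?_) (iSup₂_le fun i hi ↦ ?_))
  · rcases Nat.even_or_odd i with hev | hodd
    · by_cases h0 : e ^ i = 0
      · rw [glPart_eq_bot_of_pow_eq_zero h0]
        exact bot_le
      · exact absurd ((LinearMap.mem_skewAdjointSubmodule _).1 hi) (not_isSkewAdjoint_pow_of_even hB.1 he hev h0)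
    · exact le_iSup₂_of_le i hodd le_rfl
  · exact le_iSup₂_of_le i ((LinearMap.mem_skewAdjointSubmodule _).2 (isSkewAdjoint_pow_of_odd he hi)) le_rfl

end Aut

/-! ### §5 (rider A1-158) The complement: `𝔤𝔩^{(even)}(V(d))` is the space of self-adjoint operators -/

section Sym

variable {K : Type*} [Field K] [CharZero K] {M : Type*} [AddCommGroup M] [Module K M] [FiniteDimensional K M]
  {h e f : Module.End K M} {B : LinearMap.BilinForm K M}

omit [CharZero K] [FiniteDimensional K M] in
/-- The self-adjoint operators of `(M, ⟨ , ⟩)` are stable under `ad a` for `a ∈ 𝔞𝔲𝔱(M, ⟨ , ⟩)`: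
`⟨[a, x] u, u'⟩ = ⟨u, [a, x] u'⟩` for `a` skew and `x` self-adjoint. [folklore] -/
private theorem lie_mem_selfAdjointSubmodule {a x : Module.End K M} (ha : B.IsSkewAdjoint a)
    (hx : x ∈ B.selfAdjointSubmodule) : ⁅a, x⁆ ∈ B.selfAdjointSubmodule := by
  rw [LinearMap.mem_selfAdjointSubmodule] at hx ⊢
  intro u u'
  have ha' : ∀ v w, B (a v) w = -B v (a w) := fun v w ↦ by rw [ha v w, Pi.neg_apply, map_neg]
  change B ((a * x - x * a) u) u' = B u ((a * x - x * a) u')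
  simp only [LinearMap.sub_apply, Module.End.mul_apply, map_sub, ha', hx (a u) u']
  rw [hx u (a u')]
  ring

omit [FiniteDimensional K M] in
/-- For odd `i` and `e` skew, a non-zero `e^i` is not self-adjoint (it is skew, `isSkewAdjoint_pow_of_odd`, and a
non-zero operator is not both for a form with trivial left kernel, characteristic `≠ 2`).
[cite: LooijengaLunts1997, Appendix Lemma (7.1), p. 28 L24, L38–L40] -/
theorem not_isSelfAdjoint_pow_of_odd (hB : B.SeparatingLeft) (he : B.IsSkewAdjoint e) {i : ℕ} (hi : Odd i)
    (hne : e ^ i ≠ 0) : ¬B.IsSelfAdjoint ⇑(e ^ i) := by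
  intro hsa
  apply hne
  ext x
  rw [LinearMap.zero_apply]
  refine hB _ fun y ↦ ?_
  have h1 := hsa x y
  have h2 := isSkewAdjoint_pow_of_odd he hi x y
  rw [Pi.neg_apply, map_neg, ← h1] at h2
  have h4 : (2 : K) * B ((e ^ i) x) y = 0 := by linear_combination h2
  exact (mul_eq_zero.1 h4).resolve_left two_ne_zero

/-- **LEMMA (7.1), the complement of the last clause: `𝔤𝔩^{(even)}(V(d))` is the space of SELF-adjoint operators of
`(V(d), ⟨ , ⟩)`** — for a non-degenerate form `⟨ , ⟩` with `e, f` skew, the `⟨ , ⟩`-self-adjoint endomorphisms are the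
sum of the `𝔤𝔩^{(i)}(V(d))` with `i` even (so `𝔤𝔩(V(d)) = 𝔞𝔲𝔱 ⊕ sym` refines `⊕_i 𝔤𝔩^{(i)}` by parity: "The identity
`⟨e^i x, y⟩ = (-)^i ⟨x, e^i y⟩` shows that `e^i ∈ 𝔞𝔲𝔱(V(d))` if and only if `i` is odd" — and `e^i` is self-adjoint if
and only if `i` is even, `isSelfAdjoint_pow_of_even` / `not_isSelfAdjoint_pow_of_odd`).  Mirror of
`skewAdjointSubmodule_eq_biSup_glPart`. [cite: LooijengaLunts1997, Appendix Lemma (7.1), p. 28 L24, L38–L40; Lemma (7.5) p. 28 L87–L89 ("𝔤𝔩(U) = 𝔤_-(U) ⊕ 𝔤_0(U) ⊕ 𝔤_+(U)")] -/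
theorem selfAdjointSubmodule_eq_biSup_glPart (t : IsSl2Triple h e f) {v : M}
    (hcyc : Literature.LinearAlgebra.cyclicSubspace e v = ⊤) (hB : B.Nondegenerate) (he : B.IsSkewAdjoint e)
    (hf : B.IsSkewAdjoint f) : B.selfAdjointSubmodule = ⨆ (i : ℕ) (_ : Even i), glPart f e i := by
  have h1 := eq_biSup_glPart_of_forall_lie_mem t hcyc (N := B.selfAdjointSubmodule)
    (fun x hx ↦ lie_mem_selfAdjointSubmodule he hx) (fun x hx ↦ lie_mem_selfAdjointSubmodule hf hx)
  refine h1.trans (le_antisymm (iSup₂_le fun i hi ↦ ?_) (iSup₂_le fun i hi ↦ ?_))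
  · rcases Nat.even_or_odd i with hev | hodd
    · exact le_iSup₂_of_le i hev le_rfl
    · by_cases h0 : e ^ i = 0
      · rw [glPart_eq_bot_of_pow_eq_zero h0]
        exact bot_le
      · exact absurd ((LinearMap.mem_selfAdjointSubmodule _).1 hi) (not_isSelfAdjoint_pow_of_odd hB.1 he hodd h0)
  · exact le_iSup₂_of_le i ((LinearMap.mem_selfAdjointSubmodule _).2 (isSelfAdjoint_pow_of_even he hi)) le_rfl

/-- **`𝔤𝔩(V(d)) = 𝔞𝔲𝔱(V(d)) ⊕ sym(V(d))` along the parity of `⊕_i 𝔤𝔩^{(i)}(V(d))`**: the skew and the self-adjoint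
operators are complementary subspaces (their sum is `⊕_i 𝔤𝔩^{(i)} = 𝔤𝔩(V(d))`, and an operator which is both is `0`).
[cite: LooijengaLunts1997, Appendix Lemma (7.1), p. 28 L19–L24, L38–L40; Lemma (7.5) p. 28 L87–L89] -/
theorem isCompl_skewAdjointSubmodule_selfAdjointSubmodule (t : IsSl2Triple h e f) {v : M}
    (hcyc : Literature.LinearAlgebra.cyclicSubspace e v = ⊤) (hB : B.Nondegenerate) (he : B.IsSkewAdjoint e)
    (hf : B.IsSkewAdjoint f) : IsCompl B.skewAdjointSubmodule B.selfAdjointSubmodule := by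
  refine ⟨?_, ?_⟩
  · rw [Submodule.disjoint_def]
    intro x hx hx'
    rw [LinearMap.mem_skewAdjointSubmodule] at hx
    rw [LinearMap.mem_selfAdjointSubmodule] at hx'
    ext u
    rw [LinearMap.zero_apply]
    refine hB.1 _ fun u' ↦ ?_
    have h2 := hx u u'
    rw [Pi.neg_apply, map_neg, ← hx' u u'] at h2
    have h4 : (2 : K) * B (x u) u' = 0 := by linear_combination h2
    exact (mul_eq_zero.1 h4).resolve_left two_ne_zero
  · rw [codisjoint_iff, eq_top_iff, ← iSup_glPart_eq_top t hcyc, skewAdjointSubmodule_eq_biSup_glPart t hcyc hB he hf,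
      selfAdjointSubmodule_eq_biSup_glPart t hcyc hB he hf]
    refine iSup_le fun i ↦ ?_
    rcases Nat.even_or_odd i with hev | hodd
    · exact le_sup_of_le_right (le_iSup₂_of_le i hev le_rfl)
    · exact le_sup_of_le_left (le_iSup₂_of_le i hodd le_rfl)

end Sym

end Literature.Algebra.Lie
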